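import Mathlib.Combinatorics.SimpleGraph.Walk.Counting
import Mathlib.Combinatorics.SimpleGraph.Paths
import Mathlib.Combinatorics.SimpleGraph.Operations
import Mathlib.Topology.Algebra.InfiniteSum.ENNReal
import Summits.CriticalPhenomena.SAWScalingLimit.Theorems.SAWLeftRightFKGLeftRightFKGTP2Defs
import Summits.CriticalPhenomena.SAWScalingLimit.Theorems.SAWTotalPositivityBoundaryTP2Defs
import Summits.CriticalPhenomena.SAWScalingLimit.Theorems.SAWTotalPositivityBoundaryTP2Kernel
import Summits.CriticalPhenomena.SAWScalingLimit.Theorems.SAWTotalPositivityBoundaryTP2Symmetry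
import Summits.CriticalPhenomena.SAWScalingLimit.Theorems.SAWTotalPositivityBoundaryTP2SquareGadget
import Summits.CriticalPhenomena.SAWScalingLimit.Theorems.SAWTotalPositivityBoundaryTP2PendantThreePoint
import HarnessLib

/-!
# Corner quadruples from interlacing-only TP₂ — crux `LeftRightFKG` (stmt-CriticalPhenomena-11232),
line corner-localisation (lead c1 reshape v5), stub `stub_cornerQuadruple`

The registered stub `stub_cornerQuadruple : ∀ x > 0, BoundaryTP2.InterlacedTP2At x → CornerQuadrupleTP2At x`
(vocabulary `…SAWLeftRightFKGLeftRightFKGTP2Defs`). A CORNER QUADRUPLE `(u, w, w', u')` of a subgraph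
`H ≤ zdGraph 2` with finitely many non-isolated vertices consists of two distinct lattice neighbours `u ≠ u'`
of a vertex `p` isolated in `H` and two distinct lattice neighbours `w ≠ w'` of a vertex `q ≠ p` isolated in
`H`, with `p ≠ w, w'`, `q ≠ u, u'`, whose crossed pairing is interlaced (`Interlaced H u w w' u'`: every
self-avoiding path `u → w'` meets every self-avoiding path `w → u'`). The claim is the TP₂ inequality
`Z(u,w') Z(w,u') ≤ Z(u,w) Z(w',u')` for the fugacity-`x` path kernel `Z = BoundaryTP2.pathKernel H x`.

When `u, w, w', u'` are pairwise distinct this is verbatim an instance of `InterlacedTP2At x`. The file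
treats the endpoint coincidences:
* `u = w'` or `u' = w`: the trivial path at the common vertex shows that every path of the other crossed
  class visits it, and splitting those paths there (`Walk.takeUntil` / `Walk.dropUntil`, an injection into
  pairs of paths with lengths adding) gives the sub-multiplicativity `Z(a,b) ≤ Z(a,c) Z(c,b)`
  (`CornerQuadruple.pathKernel_le_mul_of_forall_mem`), which is the claim since `Z(c,c) = 1`;
* `u = w` only, or `u' = w'` only: the common vertex has the two lattice neighbours `p ≠ q` isolated in `H`,
  and the claim is the sibling's pendant three-point inequality `BoundaryTP2.stub_pendant_threePoint`
  (kernels from an isolated vertex vanish, which covers its support side conditions);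
* `u = w` and `u' = w'`: the claim is `Z(u,u')² ≤ 1`; hanging the two pendant edges `p u`, `q u'` on `H`
  gives `G ≤ zdGraph 2` in which `(p, u, q, u')` is pairwise distinct and interlaced at `u`, so
  `InterlacedTP2At x` yields `Z_G(p,q) Z_G(u,u') ≤ Z_G(p,u) Z_G(q,u') = x²`, while
  `Z_G(p,q) ≥ x² Z_H(u,u')` and `Z_G(u,u') ≥ Z_H(u,u')` (`CornerQuadruple.pathKernel_mul_self_le_one`).
Everything here is proved from the sibling crux's landed toolkit (`…BoundaryTP2Kernel/Symmetry/SquareGadget/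
PendantThreePoint`); `InterlacedTP2At x` enters only as a hypothesis. [folklore]
-/

noncomputable section

open MeasureTheory
open Literature.Probability.LatticeModels Literature.Probability.RandomPlanarGeometry
open scoped Classical ENNReal

namespace Summit.CriticalPhenomena.SAWScalingLimit.Theorems.LeftRightFKG.CornerLoc

open Summit.CriticalPhenomena.SAWScalingLimit.Theorems.BoundaryTP2

namespace CornerQuadruple

variable {V : Type*}

/-! ## Sub-multiplicativity of the path kernel through a vertex visited by all paths -/

/-- **Sub-multiplicativity through an unavoidable vertex.** If every self-avoiding path `a → b` of `H`
visits `c`, then `Z_H(a,b) ≤ Z_H(a,c) · Z_H(c,b)` (`0 ≤ x`): cutting a path at its visit of `c` is an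
injection into pairs of self-avoiding paths `a → c`, `c → b` under which lengths add. [folklore] -/
theorem pathKernel_le_mul_of_forall_mem (H : SimpleGraph V) (x : ℝ) (hx : 0 ≤ x) {a b c : V}
    (h : ∀ γ : H.Path a b, c ∈ γ.1.support) :
    pathKernel H x a b ≤ pathKernel H x a c * pathKernel H x c b := by
  classical
  let f : H.Path a b → H.Path a c × H.Path c b := fun γ =>
    (⟨γ.1.takeUntil c (h γ), γ.2.takeUntil _⟩, ⟨γ.1.dropUntil c (h γ), γ.2.dropUntil _⟩)
  have hf : Function.Injective f := by
    intro γ γ' hγ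
    have h1 : γ.1.takeUntil c (h γ) = γ'.1.takeUntil c (h γ') :=
      congrArg (fun q : H.Path a c × H.Path c b => q.1.1) hγ
    have h2 : γ.1.dropUntil c (h γ) = γ'.1.dropUntil c (h γ') :=
      congrArg (fun q : H.Path a c × H.Path c b => q.2.1) hγ
    refine Subtype.ext ?_
    calc γ.1 = (γ.1.takeUntil c (h γ)).append (γ.1.dropUntil c (h γ)) := (γ.1.take_spec (h γ)).symm
      _ = (γ'.1.takeUntil c (h γ')).append (γ'.1.dropUntil c (h γ')) := by rw [h1, h2]
      _ = γ'.1 := γ'.1.take_spec (h γ')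
  have hlen : ∀ γ : H.Path a b, γ.1.length = (f γ).1.1.length + (f γ).2.1.length := fun γ => by
    show γ.1.length = (γ.1.takeUntil c (h γ)).length + (γ.1.dropUntil c (h γ)).length
    rw [← SimpleGraph.Walk.length_append, SimpleGraph.Walk.take_spec]
  calc pathKernel H x a b
      = ∑' γ : H.Path a b,
          ENNReal.ofReal (x ^ (f γ).1.1.length) * ENNReal.ofReal (x ^ (f γ).2.1.length) := by
        refine tsum_congr fun γ => ?_
        rw [hlen γ, pow_add, ENNReal.ofReal_mul (pow_nonneg hx _)]
    _ ≤ ∑' q : H.Path a c × H.Path c b,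
          ENNReal.ofReal (x ^ q.1.1.length) * ENNReal.ofReal (x ^ q.2.1.length) :=
        ENNReal.tsum_comp_le_tsum_of_injective hf (fun q : H.Path a c × H.Path c b =>
          ENNReal.ofReal (x ^ q.1.1.length) * ENNReal.ofReal (x ^ q.2.1.length))
    _ = ∑' (α : H.Path a c) (β : H.Path c b),
          ENNReal.ofReal (x ^ α.1.length) * ENNReal.ofReal (x ^ β.1.length) :=
        ENNReal.tsum_prod (f := fun (α : H.Path a c) (β : H.Path c b) =>
          ENNReal.ofReal (x ^ α.1.length) * ENNReal.ofReal (x ^ β.1.length))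
    _ = ∑' α : H.Path a c,
          ENNReal.ofReal (x ^ α.1.length) * ∑' β : H.Path c b, ENNReal.ofReal (x ^ β.1.length) :=
        tsum_congr fun _ => ENNReal.tsum_mul_left
    _ = (∑' α : H.Path a c, ENNReal.ofReal (x ^ α.1.length)) *
          ∑' β : H.Path c b, ENNReal.ofReal (x ^ β.1.length) := ENNReal.tsum_mul_right
    _ = pathKernel H x a c * pathKernel H x c b := rfl

/-- Coincidence `u = w'` of a corner quadruple: `Interlaced H u w u u'` (tested against the trivial path at
`u`) says that every self-avoiding path `w → u'` visits `u`, so `Z(u,u) Z(w,u') = Z(w,u') ≤ Z(u,w) Z(u,u')`.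
[folklore] -/
theorem tp2_of_interlaced_left_eq (H : SimpleGraph V) (x : ℝ) (hx : 0 ≤ x) {u w u' : V}
    (hI : Interlaced H u w u u') :
    pathKernel H x u u * pathKernel H x w u' ≤ pathKernel H x u w * pathKernel H x u u' := by
  have hmem : ∀ Q : H.Path w u', u ∈ Q.1.support := fun Q => by
    obtain ⟨v, hvP, hvQ⟩ := hI ⟨SimpleGraph.Walk.nil, SimpleGraph.Walk.IsPath.nil⟩ Q
    simp only [SimpleGraph.Walk.mem_support_nil_iff] at hvP
    rw [← hvP]
    exact hvQ
  rw [pathKernel_self, one_mul, pathKernel_comm H x u w]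
  exact pathKernel_le_mul_of_forall_mem H x hx hmem

/-- Coincidence `u' = w` of a corner quadruple: `Interlaced H u u' w' u'` (tested against the trivial path
at `u'`) says that every self-avoiding path `u → w'` visits `u'`, so
`Z(u,w') Z(u',u') = Z(u,w') ≤ Z(u,u') Z(w',u')`. [folklore] -/
theorem tp2_of_interlaced_right_eq (H : SimpleGraph V) (x : ℝ) (hx : 0 ≤ x) {u u' w' : V}
    (hI : Interlaced H u u' w' u') :
    pathKernel H x u w' * pathKernel H x u' u' ≤ pathKernel H x u u' * pathKernel H x w' u' := by
  have hmem : ∀ P : H.Path u w', u' ∈ P.1.support := fun P => by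
    obtain ⟨v, hvP, hvQ⟩ := hI P ⟨SimpleGraph.Walk.nil, SimpleGraph.Walk.IsPath.nil⟩
    simp only [SimpleGraph.Walk.mem_support_nil_iff] at hvQ
    rw [← hvQ]
    exact hvP
  rw [pathKernel_self, mul_one, pathKernel_comm H x w' u']
  exact pathKernel_le_mul_of_forall_mem H x hx hmem

/-! ## Kernels at an isolated vertex and the pendant three-point inequality without support conditions -/

/-- No self-avoiding path joins an isolated vertex to another vertex: `Z_H(a,b) = 0` for `a ∉ H.support`,
`a ≠ b`. [folklore] -/
theorem pathKernel_eq_zero_of_not_mem_support (H : SimpleGraph V) (x : ℝ) {a b : V}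
    (ha : a ∉ H.support) (hab : a ≠ b) : pathKernel H x a b = 0 := by
  refine pathKernel_eq_zero_of_not_reachable H x ?_
  rintro ⟨γ⟩
  cases γ with
  | nil => exact hab rfl
  | cons hadj _ => exact ha hadj.mem_support_left

/-- **Pendant three-point inequality, support conditions removed.** Under `InterlacedTP2At x` (`x > 0`),
for `H ≤ zdGraph 2` with finitely many non-isolated vertices and a vertex `c` with two lattice neighbours
`q₁ ≠ q₂` isolated in `H`: `Z(c,a) Z(c,b) ≤ Z(a,b)` for `a ≠ b` both different from `c`. If `c`, `a`, `b`
are non-isolated this is `BoundaryTP2.stub_pendant_threePoint`; otherwise the left-hand side vanishes.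
[folklore] -/
theorem pendant_threePoint (x : ℝ) (hx : 0 < x) (h : InterlacedTP2At x) (H : SimpleGraph (Site 2))
    (hH : H ≤ zdGraph 2) (hfin : H.support.Finite) {c q₁ q₂ a b : Site 2}
    (hq₁ : (zdGraph 2).Adj q₁ c) (hq₂ : (zdGraph 2).Adj q₂ c) (hq : q₁ ≠ q₂)
    (hq₁H : q₁ ∉ H.support) (hq₂H : q₂ ∉ H.support) (hca : c ≠ a) (hcb : c ≠ b) (hab : a ≠ b) :
    pathKernel H x c a * pathKernel H x c b ≤ pathKernel H x a b := by
  by_cases hc : c ∈ H.support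
  · by_cases ha : a ∈ H.support
    · by_cases hb : b ∈ H.support
      · exact stub_pendant_threePoint x hx h H hH hfin c q₁ q₂ a b hq₁.symm hq₂.symm hq hq₁H hq₂H hc
          ha hb hca hcb hab
      · rw [pathKernel_comm H x c b, pathKernel_eq_zero_of_not_mem_support H x hb (Ne.symm hcb),
          mul_zero]
        exact zero_le
    · rw [pathKernel_comm H x c a, pathKernel_eq_zero_of_not_mem_support H x ha (Ne.symm hca),
        zero_mul]
      exact zero_le
  · rw [pathKernel_eq_zero_of_not_mem_support H x hc hca, zero_mul]
    exact zero_le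

/-- The pendant three-point inequality with the arguments of the kernels reversed:
`Z(a,c) Z(b,c) ≤ Z(a,b)`. [folklore] -/
theorem pendant_threePoint' (x : ℝ) (hx : 0 < x) (h : InterlacedTP2At x) (H : SimpleGraph (Site 2))
    (hH : H ≤ zdGraph 2) (hfin : H.support.Finite) {c q₁ q₂ a b : Site 2}
    (hq₁ : (zdGraph 2).Adj q₁ c) (hq₂ : (zdGraph 2).Adj q₂ c) (hq : q₁ ≠ q₂)
    (hq₁H : q₁ ∉ H.support) (hq₂H : q₂ ∉ H.support) (hca : c ≠ a) (hcb : c ≠ b) (hab : a ≠ b) :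
    pathKernel H x a c * pathKernel H x b c ≤ pathKernel H x a b := by
  rw [pathKernel_comm H x a c, pathKernel_comm H x b c]
  exact pendant_threePoint x hx h H hH hfin hq₁ hq₂ hq hq₁H hq₂H hca hcb hab

/-! ## The double pendant: `Z_H(u,u')² ≤ 1` -/

/-- **The double pendant bound.** Under `InterlacedTP2At x` (`x > 0`), let `H ≤ zdGraph 2` have finitely
many non-isolated vertices, let `p ≠ q` be isolated in `H`, `p ∼ u`, `q ∼ u'` in `ℤ²`, with `u ≠ u'`,
`q ≠ u`, `p ≠ u'`. Then `Z_H(u,u')² ≤ 1`. Proof: in `G = H ⊔ edge p u ⊔ edge q u' ≤ zdGraph 2` the leaves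
`p`, `q` have `u`, `u'` as only neighbours, the pairwise distinct quadruple `(p, u, q, u')` is interlaced
at `u`, so `Z_G(p,q) Z_G(u,u') ≤ Z_G(p,u) Z_G(q,u') = x · x` (first step at a leaf), while
`Z_G(p,q) = x² Z_{G-p-q}(u',u) ≥ x² Z_H(u,u')` and `Z_G(u,u') ≥ Z_H(u,u')`; cancel `x² ≠ 0, ∞`. [folklore] -/
theorem pathKernel_mul_self_le_one (x : ℝ) (hx : 0 < x) (h : InterlacedTP2At x)
    (H : SimpleGraph (Site 2)) (hH : H ≤ zdGraph 2) (hfin : H.support.Finite) {p q u u' : Site 2}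
    (hpq : p ≠ q) (hp : p ∉ H.support) (hq : q ∉ H.support) (hpu : (zdGraph 2).Adj p u)
    (hqu' : (zdGraph 2).Adj q u') (huu' : u ≠ u') (hqu : q ≠ u) (hpu' : p ≠ u') :
    pathKernel H x u u' * pathKernel H x u u' ≤ 1 := by
  -- members and non-members of `H.support` are distinct
  have hne : ∀ {a b : Site 2}, a ∈ H.support → b ∉ H.support → a ≠ b :=
    fun ha hb hab => hb (hab ▸ ha)
  have hpu_ne : p ≠ u := hpu.ne
  have hqu'_ne : q ≠ u' := hqu'.ne
  -- the enlarged graph `G`: hang the pendant edges `p u`, `q u'` on `H`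
  obtain ⟨G, hG⟩ :
      ∃ G : SimpleGraph (Site 2), G = H ⊔ SimpleGraph.edge p u ⊔ SimpleGraph.edge q u' := ⟨_, rfl⟩
  have hGadj : ∀ a b : Site 2, G.Adj a b ↔
      (H.Adj a b ∨ (a = p ∧ b = u ∨ a = u ∧ b = p) ∧ a ≠ b) ∨ (a = q ∧ b = u' ∨ a = u' ∧ b = q) ∧ a ≠ b :=
    fun a b => by rw [hG, SimpleGraph.sup_adj, SimpleGraph.sup_adj, SimpleGraph.edge_adj, SimpleGraph.edge_adj]
  have hle : H ≤ G := by rw [hG]; exact le_sup_left.trans le_sup_left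
  have hGzd : G ≤ zdGraph 2 := by
    rw [hG]
    exact sup_le (sup_le hH ((SimpleGraph.edge_le_iff _).2 (Or.inr hpu)))
      ((SimpleGraph.edge_le_iff _).2 (Or.inr hqu'))
  -- in `G`, the leaves `p`, `q` have `u`, `u'` as their only neighbours
  have hNp : G.neighborSet p = {u} := by
    ext z
    rw [SimpleGraph.mem_neighborSet, hGadj, Set.mem_singleton_iff]
    constructor
    · rintro ((hz | ⟨⟨-, h2⟩ | ⟨h1, -⟩, -⟩) | ⟨⟨h1, -⟩ | ⟨h1, -⟩, -⟩)
      · exact (hp hz.mem_support_left).elim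
      · exact h2
      · exact (hpu_ne h1).elim
      · exact (hpq h1).elim
      · exact (hpu' h1).elim
    · rintro rfl
      exact Or.inl (Or.inr ⟨Or.inl ⟨rfl, rfl⟩, hpu_ne⟩)
  have hNq : G.neighborSet q = {u'} := by
    ext z
    rw [SimpleGraph.mem_neighborSet, hGadj, Set.mem_singleton_iff]
    constructor
    · rintro ((hz | ⟨⟨h1, -⟩ | ⟨h1, -⟩, -⟩) | ⟨⟨-, h2⟩ | ⟨h1, -⟩, -⟩)
      · exact (hq hz.mem_support_left).elim
      · exact (hpq h1.symm).elim
      · exact (hqu h1).elim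
      · exact h2
      · exact (hqu'_ne h1).elim
    · rintro rfl
      exact Or.inr ⟨Or.inl ⟨rfl, rfl⟩, hqu'_ne⟩
  -- `G ≤ zdGraph 2` has finitely many non-isolated vertices
  have hsupp : G.support ⊆ H.support ∪ {p, u, q, u'} := by
    intro v hv
    obtain ⟨z, hz⟩ := (SimpleGraph.mem_support G).1 hv
    simp only [Set.mem_union, Set.mem_insert_iff, Set.mem_singleton_iff]
    rcases (hGadj v z).1 hz with (hz | ⟨⟨h1, -⟩ | ⟨h1, -⟩, -⟩) | ⟨⟨h1, -⟩ | ⟨h1, -⟩, -⟩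
    · exact Or.inl hz.mem_support_left
    · exact Or.inr (Or.inl h1)
    · exact Or.inr (Or.inr (Or.inl h1))
    · exact Or.inr (Or.inr (Or.inr (Or.inl h1)))
    · exact Or.inr (Or.inr (Or.inr (Or.inr h1)))
  have hfinG : G.support.Finite :=
    (hfin.union ((((Set.finite_singleton u').insert q).insert u).insert p)).subset hsupp
  -- the quadruple `(p, u, q, u')` is interlaced in `G` (at `u`), so `InterlacedTP2At x` applies
  have hint : Interlaced G p u q u' := by
    intro P Q
    obtain ⟨z, hadj, P', hP'⟩ := SimpleGraph.Walk.exists_eq_cons_of_ne hpq P.1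
    have hz : z = u := by
      have hz' := Set.ext_iff.1 hNp z
      rw [SimpleGraph.mem_neighborSet, Set.mem_singleton_iff] at hz'
      exact hz'.1 hadj
    refine ⟨u, ?_, Q.1.start_mem_support⟩
    rw [hP', SimpleGraph.Walk.support_cons]
    refine List.mem_cons_of_mem _ ?_
    rw [← hz]
    exact P'.start_mem_support
  have key : pathKernel G x p q * pathKernel G x u u' ≤ pathKernel G x p u * pathKernel G x q u' :=
    h G hGzd hfinG p u q u' hpu_ne hpq hpu' hqu.symm huu' hqu'_ne hint
  have hxle : 0 ≤ x := hx.le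
  -- `Z_G(p,u) = x = Z_G(q,u')`: the first step from a leaf
  have hC : pathKernel G x p u = ENNReal.ofReal x := by
    rw [pathKernel_firstStep_single G x hxle hpu_ne hNp, pathKernel_self, mul_one]
  have hD : pathKernel G x q u' = ENNReal.ofReal x := by
    rw [pathKernel_firstStep_single G x hxle hqu'_ne hNq, pathKernel_self, mul_one]
  -- `Z_G(p,q) = x² Z_{G-p-q}(u',u) ≥ x² Z_H(u,u')`
  set Gp := G.deleteEdges (G.incidenceSet p) with hGp_def
  have hGp_adj : ∀ a b, Gp.Adj a b ↔ G.Adj a b ∧ a ≠ p ∧ b ≠ p := deleteEdges_incidenceSet_adj G p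
  have hNq' : Gp.neighborSet q = {u'} := by
    ext z
    have hz : G.Adj q z ↔ z = u' := by
      have hz' := Set.ext_iff.1 hNq z
      rwa [SimpleGraph.mem_neighborSet, Set.mem_singleton_iff] at hz'
    rw [SimpleGraph.mem_neighborSet, hGp_adj, hz, Set.mem_singleton_iff]
    constructor
    · rintro ⟨hz, -, -⟩
      exact hz
    · rintro rfl
      exact ⟨rfl, hpq.symm, hpu'.symm⟩
  have hleGpq : H ≤ Gp.deleteEdges (Gp.incidenceSet q) := by
    intro a b hab
    rw [deleteEdges_incidenceSet_adj, hGp_adj]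
    exact ⟨⟨hle hab, hne hab.mem_support_left hp, hne hab.mem_support_right hp⟩,
      hne hab.mem_support_left hq, hne hab.mem_support_right hq⟩
  have hA : ENNReal.ofReal x * ENNReal.ofReal x * pathKernel H x u u' ≤ pathKernel G x p q := by
    rw [pathKernel_firstStep_single G x hxle hpq hNp, pathKernel_comm Gp x u q,
      pathKernel_firstStep_single Gp x hxle hqu hNq', mul_assoc, pathKernel_comm H x u u']
    exact mul_le_mul_right (mul_le_mul_right (pathKernel_mono hleGpq x u' u) _) _
  -- `Z_G(u,u') ≥ Z_H(u,u')`
  have hB : pathKernel H x u u' ≤ pathKernel G x u u' := pathKernel_mono hle x u u'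
  -- assemble and cancel `x² > 0`
  have hx0 : ENNReal.ofReal x * ENNReal.ofReal x ≠ 0 :=
    mul_ne_zero (ENNReal.ofReal_pos.2 hx).ne' (ENNReal.ofReal_pos.2 hx).ne'
  have hxtop : ENNReal.ofReal x * ENNReal.ofReal x ≠ ∞ :=
    ENNReal.mul_ne_top ENNReal.ofReal_ne_top ENNReal.ofReal_ne_top
  rw [← ENNReal.mul_le_mul_iff_right hx0 hxtop, mul_one]
  calc ENNReal.ofReal x * ENNReal.ofReal x * (pathKernel H x u u' * pathKernel H x u u')
      = ENNReal.ofReal x * ENNReal.ofReal x * pathKernel H x u u' * pathKernel H x u u' :=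
        (mul_assoc _ _ _).symm
    _ ≤ pathKernel G x p q * pathKernel G x u u' := mul_le_mul' hA hB
    _ ≤ pathKernel G x p u * pathKernel G x q u' := key
    _ = ENNReal.ofReal x * ENNReal.ofReal x := by rw [hC, hD]

end CornerQuadruple

/-- REGISTERED STUB `stub_cornerQuadruple` (line corner-localisation, lead c1 reshape v5): for every `x > 0`,
the interlacing-only TP₂ `BoundaryTP2.InterlacedTP2At x` signs every corner quadruple, endpoint coincidences
included (`CornerQuadrupleTP2At x`). The pairwise distinct case is the hypothesis itself for the quadruple
`(u, w, w', u')`; `u = w'` / `u' = w` are the sub-multiplicativity of the kernel through the common vertex;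
`u = w` only / `u' = w'` only are the pendant three-point inequality at the common vertex (whose lattice
neighbours `p ≠ q` are isolated in `H`); `u = w ∧ u' = w'` is the double pendant bound `Z(u,u')² ≤ 1`.
[folklore] -/
theorem stub_cornerQuadruple : ∀ x : ℝ, 0 < x → BoundaryTP2.InterlacedTP2At x → CornerQuadrupleTP2At x := by
  intro x hx h H hH hfin p q u u' w w' hpq hp hq hpu hpu' hqw hqw' huu' hww' _ hpw' hqu _ hI
  by_cases h1 : u = w'
  · subst h1
    exact CornerQuadruple.tp2_of_interlaced_left_eq H x hx.le hI
  by_cases h2 : u' = w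
  · subst h2
    exact CornerQuadruple.tp2_of_interlaced_right_eq H x hx.le hI
  by_cases h3 : u = w
  · subst h3
    by_cases h4 : u' = w'
    · subst h4
      rw [pathKernel_self, pathKernel_self, one_mul]
      exact CornerQuadruple.pathKernel_mul_self_le_one x hx h H hH hfin hpq hp hq hpu hqw' huu' hqu hpw'
    · rw [pathKernel_self, one_mul]
      exact CornerQuadruple.pendant_threePoint x hx h H hH hfin hpu hqw hpq hp hq h1 huu' (Ne.symm h4)
  by_cases h4 : u' = w'
  · subst h4
    rw [pathKernel_self, mul_one]
    exact CornerQuadruple.pendant_threePoint' x hx h H hH hfin hpu' hqw' hpq hp hq (Ne.symm huu') h2 h3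
  -- the generic case: `u, w, w', u'` pairwise distinct
  exact h H hH hfin u w w' u' h3 h1 huu' hww' (Ne.symm h2) (Ne.symm h4) hI

end Summit.CriticalPhenomena.SAWScalingLimit.Theorems.LeftRightFKG.CornerLoc

end
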